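import Summits.QuantumFields.YangMills.Theorems.FluctuationComparisonRegPrIntLS2BetaTubularChartActTransversal
import Summits.QuantumFields.YangMills.Theorems.FluctuationComparisonRegPrIntLS2BetaSignedCombLipschitz
import Summits.QuantumFields.YangMills.Theorems.FluctuationComparisonRegPrIntLS2BetaResidualSubgroup
import Summits.QuantumFields.YangMills.Theorems.FluctuationComparisonRegPrIntLS2BetaResidualGaugeCentral
import Summits.QuantumFields.YangMills.Theorems.FluctuationComparisonRegPrIntLS2BetaLaplaceInstGroupChart
import HarnessLib

/-!
# LINE g18-1 S2β LAPLACE — THE DOCKED (C3β″) CHART, TRANSVERSAL EDITION: (T2) «OFF-PIVOT QUADRATIC TRANSVERSALITY OF THE TUBE»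

Crux `stmt-QuantumFields-20520` (`…Theses.UnitScaleTilt.FluctuationComparisonRegPrIntL`); cell `ym3-torus` (HUMAN RULING D-0037 — YM₃ on T³ is ladder rung
R3, not the Clay problem), width seat `ym3-torus-px21` g10; count-neutral helper (`--kind proof --supports stmt-QuantumFields-20520 --as helper`).
Theorems only: 0 `def`, 0 `instance`, 0 `notation`, 0 `sorry`.

WHAT.  `exists_tubularHaarChart_pivotAct_transversal` = the docked smooth chart ✓`…TubularChartDock.exists_tubularHaarChart_pivotAct_smooth` (p740153: the
13 chart rows of w5-20520's LIMIT-INST for `S := residualSubgroup F hJK`, `act := pivotAct F hJK (iterCentralBond (K − J))`, plus `ContDiff ℝ ⊤ σ`) with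
THREE MORE ROWS on the transversal `σ` alone:
* (D0) `σ y = U₀` on the comb bonds AND on the pivots, for every `y`;
* (D1) `combTransporter (K − J) (σ y) = combTransporter (K − J) U₀` for every `y`;
* (T2) `∃ c₁ > 0, ∀ᶠ y in 𝓝 0, c₁‖y‖² ≤ ⨅_{w residual} Σ_{ℓ ∉ pivots} dist1 ((σ y) ℓ · (w • U₀)ℓ⁻¹)²` — the transversal leaves the whole RESIDUAL ORBIT of
  `U₀` quadratically in the off-pivot `dist1²`-distance; the right-hand side is TOKEN-IDENTICAL to the binder `ht` of px11 g10's
  ✓`…S2BetaFibreGrowth.growth_of_offPivot_orbitDist_le` (at `z := σ y`, `t := c₁‖y‖²`), which turns GAP♯ + (T2) + the local carrier row into the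
  transversal-Hessian GROWTH row of w4-20520 g15's v8 Laplace docking.
PROOF of (T2): px21's (A0)–(A2) (✓`…TubularChartActTransversal`: `σ` moves no comb∕pivot bond, the comb transporter `T` is constant along `σ`, and
`c‖y‖² ≤ Σ_b dist1(σ y b · U₀ b⁻¹)²`), then for a residual `w`: `w = c · w′` with `c` central and `w′` ROOTED (✓`exists_central_isResidual_of_residual`), the
free-bond coordinates `u_V(b) = T_V(b₋)V(b)T_V(b₊)⁻¹` satisfy `u_{w′•U₀} = u_{U₀}` (✓`coord_gaugeAct_of_rootTrivial`) and `u_{σ y}(b)·u_{U₀}(b)⁻¹` is a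
conjugate of `σ y(b)·U₀(b)⁻¹` (by (D1)), so `Σ_{b ∉ piv} dist1(σ y b·U₀ b⁻¹)² = Σ_{b ∉ piv} dist1(u_{σ y}(b)·u_{w′•U₀}(b)⁻¹)² ≤ C·Σ_{ℓ ∉ piv} dist1(σ y ℓ·(w′•U₀)ℓ⁻¹)²`
(✓`exists_sum_dist1_coord_le_offPivot`), and the pivot terms of (A2) vanish by (D0); `c₁ := c∕(C+1)`.
HONEST: a chart-side letter; proves no stub; LAPLACE∕S2β∕crux 20520 NOT proved; rung R3 — NOT d = 4, NOT infinite volume, NOT a mass gap, NOT Clay.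
[cite: Balaban1985Variational, Thm 1 (8)-(10) p.279, (4) p.278, (19) p.281; Balaban1987RG1, p.256; Helgason2000, Ch. I §1 Thm 1.14 (13) p.96]
-/

noncomputable section

open MeasureTheory MeasureTheory.Measure Filter Topology Set Function Metric
open scoped ENNReal Matrix.Norms.L2Operator
open Literature.MathematicalPhysics.QuantumFieldTheory.Balaban1983to89
open Literature.MathematicalPhysics.QuantumFieldTheory.Balaban1983to89.T3ContinuumYM3Torus
open Literature.MathematicalPhysics.QuantumFieldTheory.Balaban1983to89.T3UnitLawDensityEML
open Literature.MathematicalPhysics.QuantumFieldTheory.Balaban1983to89.T3TiltDescent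
open Literature.MathematicalPhysics.QuantumFieldTheory.Balaban1983to89.B15DeterminingSets (embIter)
open Literature.MathematicalPhysics.QuantumFieldTheory.Balaban1983to89.B12GaugeOrbits021 (IsResidual)
open scoped Literature.MathematicalPhysics.QuantumFieldTheory.Balaban1983to89.T3OrbitAverage
open Summit.QuantumFields.YangMills.Theorems.FluctuationComparisonRegPrIntLWregChain (iterCentralBond)
open Summit.QuantumFields.YangMills.Theorems.FluctuationComparisonRegPrIntLS2BetaResidualSubgroup
open Summit.QuantumFields.YangMills.Theorems.FluctuationComparisonRegPrIntLS2BetaResidualGaugeRooted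
open Summit.QuantumFields.YangMills.Theorems.FluctuationComparisonRegPrIntLS2BetaLaplaceInstGroupChart
open Summit.QuantumFields.YangMills.Theorems.FluctuationComparisonRegPrIntLS2BetaTubularChartActTransversal
open Summit.QuantumFields.YangMills.Theorems.FluctuationComparisonRegPrIntLS2BetaSignedComb (combTransporter)
open Summit.QuantumFields.YangMills.Theorems.FluctuationComparisonRegPrIntLS2BetaSignedCombKill (combSet)
open Summit.QuantumFields.YangMills.Theorems.FluctuationComparisonRegPrIntLS2BetaSignedCombLipschitz
open Summit.QuantumFields.YangMills.Theorems.FluctuationComparisonRegPrIntLS2BetaResidualGauge (residual_one)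
open Summit.QuantumFields.YangMills.Theorems.FluctuationComparisonRegPrIntLS2BetaResidualGaugeCentral (exists_central_isResidual_of_residual)

namespace Summit.QuantumFields.YangMills.Theorems.FluctuationComparisonRegPrIntLS2BetaTubularChartDockTransversal

variable (F : T3Family) {J K : ℕ} (hJK : J ≤ K)

/-! ## §1  (A0) + (A1) + (A2) ⇒ (T2): from «`σ` leaves `U₀` quadratically» to «`σ` leaves the residual ORBIT of `U₀` quadratically, off the pivots» -/

/-- ★★ **(T2) FROM THE THREE TRANSVERSAL ROWS OF THE LETTER**: if a family `σ : Y → SU(2)^{bonds}` through `U₀` moves no comb and no pivot bond (A0),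
has constant signed comb transporter `combTransporter (K−J) (σ y) = combTransporter (K−J) U₀` (A1), and leaves `U₀` quadratically,
`c‖y‖² ≤ Σ_b dist1(σ y b · U₀ b⁻¹)²` near `0` (A2), then it leaves the whole RESIDUAL ORBIT of `U₀` quadratically in the off-pivot `dist1²`-distance:
`∃ c₁ > 0, ∀ᶠ y in 𝓝 0, c₁‖y‖² ≤ ⨅_{w residual} Σ_{ℓ ∉ pivots} dist1 (σ y ℓ · (w • U₀)ℓ⁻¹)²`.  Proof: a residual `w` is `c · w′` with `c` central and `w′`
rooted (✓`exists_central_isResidual_of_residual`), the free-bond coordinates `u_V(b) = T_V(b₋)V(b)T_V(b₊)⁻¹` do not see `w′` (✓`coord_gaugeAct_of_rootTrivial`),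
`u_{σ y}(b)·u_{U₀}(b)⁻¹` is a conjugate of `σ y(b)·U₀(b)⁻¹` by (A1), the pivot terms of (A2) vanish by (A0), and ✓`exists_sum_dist1_coord_le_offPivot` bounds the
`u`-distance by `C ×` the off-pivot orbit distance; `c₁ := c∕(C+1)`. [cite: Balaban1985Variational, Thm 1 (10) p.279, (19) p.281; Balaban1987RG1, p.256] -/
theorem offPivot_transversal_of_rows (hk : K - J ≤ (F.P K).m + (F.P K).K) {Y : Type*} [SeminormedAddCommGroup Y]
    {σ : Y → GaugeField (F.P K) 0 (Matrix.specialUnitaryGroup (Fin 2) ℂ)} {U₀ : GaugeField (F.P K) 0 (Matrix.specialUnitaryGroup (Fin 2) ℂ)}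
    (hσF : ∀ y, ∀ b ∈ (combSet (K - J) : Set (PBond (F.P K) 0)) ∪ Set.range (iterCentralBond (P := F.P K) (K - J)), σ y b = U₀ b)
    (hσT : ∀ y, combTransporter (K - J) (σ y) = combTransporter (K - J) U₀)
    (hσgr : ∃ c : ℝ, 0 < c ∧ ∀ᶠ y in 𝓝 (0 : Y), c * ‖y‖ ^ 2 ≤ ∑ b : PBond (F.P K) 0, dist1 (σ y b * (U₀ b)⁻¹) ^ 2) :
    ∃ c₁ : ℝ, 0 < c₁ ∧ ∀ᶠ y in 𝓝 (0 : Y),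
      c₁ * ‖y‖ ^ 2 ≤ ⨅ w : {w : Site (F.P K) 0 → Matrix.specialUnitaryGroup (Fin 2) ℂ |
            ∀ U : GaugeField (F.P K) 0 (Matrix.specialUnitaryGroup (Fin 2) ℂ),
              descendTo F ℰp J K hJK (GaugeField.gaugeAct w U) = descendTo F ℰp J K hJK U},
          ∑ ℓ ∈ Finset.univ.filter (fun ℓ : PBond (F.P K) 0 => ∀ c, iterCentralBond (P := F.P K) (K - J) c ≠ ℓ),
            dist1 (σ y ℓ * ((GaugeField.gaugeAct (w : Site (F.P K) 0 → Matrix.specialUnitaryGroup (Fin 2) ℂ) U₀) ℓ)⁻¹) ^ 2 := by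
  classical
  obtain ⟨c, hc, hev⟩ := hσgr
  obtain ⟨C, hC0, hC⟩ := exists_sum_dist1_coord_le_offPivot (P := F.P K) (n := Fin 2) hk
  haveI : Nonempty {w : Site (F.P K) 0 → Matrix.specialUnitaryGroup (Fin 2) ℂ |
      ∀ U : GaugeField (F.P K) 0 (Matrix.specialUnitaryGroup (Fin 2) ℂ),
        descendTo F ℰp J K hJK (GaugeField.gaugeAct w U) = descendTo F ℰp J K hJK U} := ⟨⟨1, residual_one F hJK⟩⟩
  refine ⟨c / (C + 1), by positivity, ?_⟩
  filter_upwards [hev] with y hy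
  refine le_ciInf fun w => ?_
  -- the residual `w` acts like a ROOTED `w′`
  obtain ⟨cc, -, hres, hact⟩ := exists_central_isResidual_of_residual F hJK w.2
  set w' : Site (F.P K) 0 → Matrix.specialUnitaryGroup (Fin 2) ℂ := (fun _ => cc⁻¹) * (w : Site (F.P K) 0 → Matrix.specialUnitaryGroup (Fin 2) ℂ)
    with hw'
  rw [← hact U₀]
  -- the off-pivot set and the off-pivot orbit distance
  set OFF : Finset (PBond (F.P K) 0) :=
    Finset.univ.filter (fun ℓ : PBond (F.P K) 0 => ∀ c, iterCentralBond (P := F.P K) (K - J) c ≠ ℓ) with hOFF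
  set R : ℝ := ∑ ℓ ∈ OFF, dist1 (σ y ℓ * ((GaugeField.gaugeAct w' U₀) ℓ)⁻¹) ^ 2 with hR
  have hR0 : 0 ≤ R := Finset.sum_nonneg fun _ _ => sq_nonneg _
  -- (i) the pivot terms of (A2) vanish: `σ y = U₀` on the pivots
  have h1 : ∑ b : PBond (F.P K) 0, dist1 (σ y b * (U₀ b)⁻¹) ^ 2 = ∑ b ∈ OFF, dist1 (σ y b * (U₀ b)⁻¹) ^ 2 := by
    have hz : ∑ b ∈ Finset.univ.filter (fun ℓ : PBond (F.P K) 0 => ¬ ∀ c, iterCentralBond (P := F.P K) (K - J) c ≠ ℓ),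
        dist1 (σ y b * (U₀ b)⁻¹) ^ 2 = 0 := by
      refine Finset.sum_eq_zero fun b hb => ?_
      rw [Finset.mem_filter] at hb
      obtain ⟨c', hc'⟩ := not_forall_not.1 hb.2
      rw [hσF y b (Or.inr ⟨c', hc'⟩), mul_inv_cancel, GaugeGroup.dist1_one]
      ring
    rw [← Finset.sum_filter_add_sum_filter_not Finset.univ (fun ℓ : PBond (F.P K) 0 => ∀ c, iterCentralBond (P := F.P K) (K - J) c ≠ ℓ),
      hz, add_zero]
  -- (ii) in free-bond coordinates: `dist1(σ y b · U₀ b⁻¹) = dist1(u_{σ y}(b) · u_{U₀}(b)⁻¹)` (the transporter is constant along `σ`) and `u_{U₀} = u_{w′•U₀}`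
  have h2 : ∀ b : PBond (F.P K) 0, dist1 (σ y b * (U₀ b)⁻¹) =
      dist1 ((combTransporter (K - J) (σ y) b.src * σ y b * (combTransporter (K - J) (σ y) b.tgt)⁻¹) *
        (combTransporter (K - J) (GaugeField.gaugeAct w' U₀) b.src * GaugeField.gaugeAct w' U₀ b *
          (combTransporter (K - J) (GaugeField.gaugeAct w' U₀) b.tgt)⁻¹)⁻¹) := by
    intro b
    rw [coord_gaugeAct_of_rootTrivial (K - J) hres U₀ b, hσT y,
      show combTransporter (K - J) U₀ b.src * σ y b * (combTransporter (K - J) U₀ b.tgt)⁻¹ *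
          (combTransporter (K - J) U₀ b.src * U₀ b * (combTransporter (K - J) U₀ b.tgt)⁻¹)⁻¹ =
        combTransporter (K - J) U₀ b.src * (σ y b * (U₀ b)⁻¹) * (combTransporter (K - J) U₀ b.src)⁻¹ by group,
      GaugeGroup.dist1_conj]
  -- (iii) the comb Lipschitz bound
  have h3 : ∑ b ∈ OFF, dist1 (σ y b * (U₀ b)⁻¹) ^ 2 ≤ C * R := by
    rw [Finset.sum_congr rfl fun b _ => by rw [h2 b]]
    exact hC (σ y) (GaugeField.gaugeAct w' U₀)
  have h4 : c * ‖y‖ ^ 2 ≤ C * R := hy.trans (h1.le.trans h3)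
  rw [div_mul_eq_mul_div, div_le_iff₀ (by positivity)]
  nlinarith [h4, hR0, hC0]

/-! ## §2  The docked chart rows, transversal edition -/

/-- ★★★ **THE (C3β″) CHART, DOCKED, TRANSVERSAL EDITION** — for `S := residualSubgroup F hJK`, `act := pivotAct F hJK (iterCentralBond (K − J))` and every
base point `U₀`: the rows of ✓`…TubularChartDock.exists_tubularHaarChart_pivotAct_smooth` (group chart `e`, smooth continuous transversal `σ` through `U₀`,
window `W`, density `Jd`, radius `ρ`, the chart identity) PLUS (D0) `σ y = U₀` on `combSet (K−J) ∪ range (iterCentralBond (K−J))`, (D1)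
`combTransporter (K−J) (σ y) = combTransporter (K−J) U₀`, and (T2) «OFF-PIVOT QUADRATIC TRANSVERSALITY OF THE TUBE»:
`∃ c₁ > 0, ∀ᶠ y in 𝓝 0, c₁‖y‖² ≤ ⨅_{w residual} Σ_{ℓ ∉ pivots} dist1 ((σ y) ℓ · (w • U₀)ℓ⁻¹)²` (right-hand side = the `ht` binder of
✓`…S2BetaFibreGrowth.growth_of_offPivot_orbitDist_le`). [cite: Balaban1985Variational, Thm 1 (8)-(10) p.279, (19) p.281; Helgason2000, Ch. I §1 Thm 1.14 (13) p.96;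
Balaban1985Averaging, (8), (10) p.18] -/
theorem exists_tubularHaarChart_pivotAct_transversal (hk : K - J ≤ (F.P K).m + (F.P K).K) (dZ dV : ℕ)
    (hdZ : dZ = Module.finrank ℝ (specialUnitaryLogChart (Fin 2)).lie *
      ((Fintype.card (Site (F.P K) 0) - Fintype.card (Site (F.P K) (K - J))) + Fintype.card (PBond (F.P K) (K - J))))
    (hdV : dV = Module.finrank ℝ (specialUnitaryLogChart (Fin 2)).lie *
        (Fintype.card (PBond (F.P K) 0) - Fintype.card (PBond (F.P K) (K - J))) -
      Module.finrank ℝ (specialUnitaryLogChart (Fin 2)).lie * (Fintype.card (Site (F.P K) 0) - Fintype.card (Site (F.P K) (K - J))))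
    (U₀ : GaugeField (F.P K) 0 (Matrix.specialUnitaryGroup (Fin 2) ℂ)) :
    ∃ (e : EuclideanSpace ℝ (Fin dZ) → residualSubgroup F hJK × (PBond (F.P K) (K - J) → Matrix.specialUnitaryGroup (Fin 2) ℂ))
      (σ : EuclideanSpace ℝ (Fin dV) → GaugeField (F.P K) 0 (Matrix.specialUnitaryGroup (Fin 2) ℂ))
      (W : Set (EuclideanSpace ℝ (Fin dZ) × EuclideanSpace ℝ (Fin dV)))
      (Jd : EuclideanSpace ℝ (Fin dZ) × EuclideanSpace ℝ (Fin dV) → ℝ) (ρ : ℝ),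
      Continuous e ∧ e 0 = 1 ∧
      𝓝 (1 : residualSubgroup F hJK × (PBond (F.P K) (K - J) → Matrix.specialUnitaryGroup (Fin 2) ℂ)) ≤ map e (𝓝 0) ∧
      Continuous σ ∧ σ 0 = U₀ ∧
      ContDiff ℝ ⊤ (fun y : EuclideanSpace ℝ (Fin dV) => fun b : PBond (F.P K) 0 =>
        ((σ y b : Matrix.specialUnitaryGroup (Fin 2) ℂ) : Matrix (Fin 2) (Fin 2) ℂ)) ∧
      (∀ y, ∀ b ∈ (combSet (K - J) : Set (PBond (F.P K) 0)) ∪ Set.range (iterCentralBond (P := F.P K) (K - J)), σ y b = U₀ b) ∧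
      (∀ y, combTransporter (K - J) (σ y) = combTransporter (K - J) U₀) ∧
      (∃ c₁ : ℝ, 0 < c₁ ∧ ∀ᶠ y in 𝓝 (0 : EuclideanSpace ℝ (Fin dV)),
        c₁ * ‖y‖ ^ 2 ≤ ⨅ w : {w : Site (F.P K) 0 → Matrix.specialUnitaryGroup (Fin 2) ℂ |
              ∀ U : GaugeField (F.P K) 0 (Matrix.specialUnitaryGroup (Fin 2) ℂ),
                descendTo F ℰp J K hJK (GaugeField.gaugeAct w U) = descendTo F ℰp J K hJK U},
            ∑ ℓ ∈ Finset.univ.filter (fun ℓ : PBond (F.P K) 0 => ∀ c, iterCentralBond (P := F.P K) (K - J) c ≠ ℓ),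
              dist1 (σ y ℓ * ((GaugeField.gaugeAct (w : Site (F.P K) 0 → Matrix.specialUnitaryGroup (Fin 2) ℂ) U₀) ℓ)⁻¹) ^ 2) ∧
      𝓝 (σ 0) ≤ map (fun p : EuclideanSpace ℝ (Fin dZ) × EuclideanSpace ℝ (Fin dV) =>
        pivotAct F hJK (iterCentralBond (P := F.P K) (K - J)) (e p.1) (σ p.2)) (𝓝 0) ∧
      IsOpen W ∧
      InjOn (fun p : EuclideanSpace ℝ (Fin dZ) × EuclideanSpace ℝ (Fin dV) =>
        pivotAct F hJK (iterCentralBond (P := F.P K) (K - J)) (e p.1) (σ p.2)) W ∧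
      ContinuousOn Jd W ∧ (∀ w ∈ W, 0 ≤ Jd w) ∧
      (fieldMeasure (F.P K) 0 (Matrix.specialUnitaryGroup (Fin 2) ℂ)).restrict
          ((fun p : EuclideanSpace ℝ (Fin dZ) × EuclideanSpace ℝ (Fin dV) =>
            pivotAct F hJK (iterCentralBond (P := F.P K) (K - J)) (e p.1) (σ p.2)) '' W) =
        ((((volume : Measure (EuclideanSpace ℝ (Fin dZ))).prod (volume : Measure (EuclideanSpace ℝ (Fin dV)))).restrict W).withDensity
            fun w => ENNReal.ofReal (Jd w)).map
          (fun p : EuclideanSpace ℝ (Fin dZ) × EuclideanSpace ℝ (Fin dV) =>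
            pivotAct F hJK (iterCentralBond (P := F.P K) (K - J)) (e p.1) (σ p.2)) ∧
      0 < ρ ∧ closedBall (0 : EuclideanSpace ℝ (Fin dZ)) ρ ×ˢ {(0 : EuclideanSpace ℝ (Fin dV))} ⊆ W ∧
      0 < ∫ z in ball (0 : EuclideanSpace ℝ (Fin dZ)) ρ, Jd (z, 0) := by
  classical
  obtain ⟨e, σ, W, Jd, ρ₀, hec, he0, heres, hsurj, hσc, hσ0, hσs, hσF, hσT, hσgr, hWo, hρ₀, hball, hinj, hopen, hJc, hJ0, hJpos, hchart⟩ :=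
    exists_tubularHaarChart_act_transversal (F.P K) hk dZ dV hdZ hdV U₀
  -- lift `e` into the subgroup (rooted ⇒ residual, px11's GAP 4)
  set el : EuclideanSpace ℝ (Fin dZ) → residualSubgroup F hJK × (PBond (F.P K) (K - J) → Matrix.specialUnitaryGroup (Fin 2) ℂ) :=
    fun z => (⟨(e z).1, residual_of_isResidual F hJK (heres z)⟩, (e z).2) with hel
  -- the action of record through the lift IS the letter's tube map (definitionally)
  have hΘ : (fun p : EuclideanSpace ℝ (Fin dZ) × EuclideanSpace ℝ (Fin dV) =>
      pivotAct F hJK (iterCentralBond (P := F.P K) (K - J)) (el p.1) (σ p.2)) =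
      fun p => Function.extend (iterCentralBond (P := F.P K) (K - J)) (fun c => (e p.1).2 c * σ p.2 (iterCentralBond (P := F.P K) (K - J) c))
        (GaugeField.gaugeAct (e p.1).1 (σ p.2)) := by
    funext p; rfl
  -- (0,0) ∈ W and continuity of `Jd` there; shrink the radius so that `J(z,0) > J(0,0)/2` on the ball
  have h0W : ((0 : EuclideanSpace ℝ (Fin dZ)), (0 : EuclideanSpace ℝ (Fin dV))) ∈ W :=
    hball (Set.mk_mem_prod (Metric.mem_closedBall_self hρ₀.le) rfl)
  have hJat : ContinuousAt Jd ((0 : EuclideanSpace ℝ (Fin dZ)), (0 : EuclideanSpace ℝ (Fin dV))) :=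
    hJc.continuousAt (hWo.mem_nhds h0W)
  obtain ⟨δ, hδ, hδJ⟩ := Metric.continuousAt_iff.1 hJat (Jd (0, 0) / 2) (by linarith)
  set ρ : ℝ := min ρ₀ (δ / 2) with hρ
  have hρpos : 0 < ρ := lt_min hρ₀ (by linarith)
  have hρle : ρ ≤ ρ₀ := min_le_left _ _
  have hρδ : ρ < δ := lt_of_le_of_lt (min_le_right _ _) (by linarith)
  have hballW : closedBall (0 : EuclideanSpace ℝ (Fin dZ)) ρ ×ˢ {(0 : EuclideanSpace ℝ (Fin dV))} ⊆ W :=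
    (Set.prod_mono (Metric.closedBall_subset_closedBall hρle) Subset.rfl).trans hball
  -- lower bound `J(z,0) ≥ J(0,0)/2` on the ball
  have hlow : ∀ z ∈ ball (0 : EuclideanSpace ℝ (Fin dZ)) ρ, Jd (0, 0) / 2 ≤ Jd (z, 0) := by
    intro z hz
    have hd : dist ((z, (0 : EuclideanSpace ℝ (Fin dV))) : EuclideanSpace ℝ (Fin dZ) × EuclideanSpace ℝ (Fin dV)) (0, 0) < δ := by
      rw [Prod.dist_eq, dist_self]
      exact max_lt (lt_trans (mem_ball.1 hz) hρδ) hδ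
    have := hδJ hd
    rw [Real.dist_eq] at this
    have := (abs_lt.1 this).1
    linarith
  refine ⟨el, σ, W, Jd, ρ, ?_, ?_, ?_, hσc, hσ0, hσs, hσF, hσT, ?_, ?_, hWo, ?_, hJc, hJ0, ?_, hρpos, hballW, ?_⟩
  · -- `el` continuous (w5's packaged row)
    exact (groupChart_rows_of_rooted F hJK hec he0 heres hsurj).1
  · -- `el 0 = 1`
    exact (groupChart_rows_of_rooted F hJK hec he0 heres hsurj).2.1
  · -- `𝓝 1 ≤ map el (𝓝 0)`: near `1`, residual = rooted (w5's packaged row)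
    exact (groupChart_rows_of_rooted F hJK hec he0 heres hsurj).2.2
  · -- (T2) OFF-PIVOT QUADRATIC TRANSVERSALITY OF THE TUBE: rows (A0)(A1)(A2) of the letter, by §1
    exact offPivot_transversal_of_rows F hJK hk hσF hσT hσgr
  · -- `𝓝 (σ 0) ≤ map Θ (𝓝 0)`
    rw [hΘ, hσ0]
    exact Filter.le_map fun s hs => hopen s hs
  · -- injectivity on `W`
    rw [hΘ]; exact hinj
  · -- the chart identity
    rw [hΘ]; exact hchart
  · -- `0 < ∫_{ball 0 ρ} J(z,0) dz`
    have hballW' : ∀ z ∈ closedBall (0 : EuclideanSpace ℝ (Fin dZ)) ρ, ((z, (0 : EuclideanSpace ℝ (Fin dV))) : _ × _) ∈ W :=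
      fun z hz => hballW (Set.mk_mem_prod hz rfl)
    have hcontJ : ContinuousOn (fun z : EuclideanSpace ℝ (Fin dZ) => Jd (z, 0)) (closedBall 0 ρ) :=
      hJc.comp (Continuous.continuousOn (continuous_id.prodMk continuous_const)) fun z hz => hballW' z hz
    have hint : IntegrableOn (fun z : EuclideanSpace ℝ (Fin dZ) => Jd (z, 0)) (ball 0 ρ) volume :=
      (hcontJ.integrableOn_compact (isCompact_closedBall _ _)).mono_set ball_subset_closedBall
    have hvol : 0 < (volume (ball (0 : EuclideanSpace ℝ (Fin dZ)) ρ)).toReal :=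
      ENNReal.toReal_pos (measure_ball_pos volume _ hρpos).ne' measure_ball_lt_top.ne
    have hconst : ∫ z in ball (0 : EuclideanSpace ℝ (Fin dZ)) ρ, Jd (0, 0) / 2 = (volume (ball (0 : EuclideanSpace ℝ (Fin dZ)) ρ)).toReal * (Jd (0, 0) / 2) := by
      rw [setIntegral_const, smul_eq_mul]; rfl
    calc (0 : ℝ) < (volume (ball (0 : EuclideanSpace ℝ (Fin dZ)) ρ)).toReal * (Jd (0, 0) / 2) := mul_pos hvol (by linarith)
      _ = ∫ z in ball (0 : EuclideanSpace ℝ (Fin dZ)) ρ, Jd (0, 0) / 2 := hconst.symm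
      _ ≤ ∫ z in ball (0 : EuclideanSpace ℝ (Fin dZ)) ρ, Jd (z, 0) :=
          setIntegral_mono_on (integrableOn_const measure_ball_lt_top.ne) hint measurableSet_ball fun z hz => hlow z hz

end Summit.QuantumFields.YangMills.Theorems.FluctuationComparisonRegPrIntLS2BetaTubularChartDockTransversal

end
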